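import Summits.BirchSwinnertonDyer.BirchSwinnertonDyer.Theses.PrintX9
import Summits.BirchSwinnertonDyer.BirchSwinnertonDyer.Theorems.PrintX9HowardContainmentLightFrameOfPrintDepthPosLocalized
import Literature.NumberTheory.EllipticCurves.HeegnerCharIdealScalingTransferProofs
import Literature.NumberTheory.EllipticCurves.HeegnerModuleScalingDivisibilityProofs
import Literature.NumberTheory.EllipticCurves.ModularParametrizationScalingProofs
import HarnessLib

/-!
# Line `torsion-depth-light-ofprint` on crux `HowardContainmentLightFrameOfPrint` (stmt-BirchSwinnertonDyer-25235),
# RESHAPED CUT v3 — the SCALING REDUCTION (x9-p2, 2026-08-28)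

The crux (route PrintX9, rev 18+) is `MastellaZermanHowardDivisibility → CGLSHowardDivisibilityLocalized →
AnticyclotomicTowerInRingClassFields → HowardContainmentLightFrame`; its conclusion `A_light` asks, on every
rank-one light X9 Heegner frame, for `∃ (jbar) (D) (F : HeegnerFamily N_E W K κ jbar) (X), I(ℋ_F)² ⊆ char_Λ(X_tors)`
with the family `F` — hence ITS modular parametrisation `F.Dt` — EXISTENTIALLY quantified. The registered cut
(stubs s2 `stub_depthZero_divisibleClassNumber` = Howard's Thm B re-run at `p ∣ h_K`, δ = 0, and s4
`stub_depthPos_muPart` = the μ-part promotion at δ > 0; s3 landed, p607064) is replaced here by ONE composition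
valid at EVERY torsion depth and ANY class number:

1. CGLS 2022 Thm. 4.1.3 by name (`hCGLS`; hypotheses by the landed `X9.thm413Hypotheses_of_lightFrame`, corank one
   by `X9.selmerCorank_eq_one_of_rank_one`, p607064): `𝔖 = D.S` f.g. of `Λ`-rank one and, for the datum `C` of
   step 2, `m` with `(p^m)·I(Λκ_C)² ⊆ char(X_tors)`.
2. `stub_exists_stabilized_heegnerModule_le_smul` (BEYOND TYPED PRINT — the one research stub): for the tree
   family `F₀` ON `(Dt, H.β)` there are a COHERENT stabilised datum `C` ON `(F₀.Dt, F₀.β)` and `a` with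
   `(p^a)·ℋ_∞(F₀) ⊆ Λκ_C` (universal norms + vertical distribution relations: Perrin-Riou 1987 §3.3–3.4,
   Darmon 2004 Prop. 3.10, CGLS Rem. 4.1.4; CGLS Thm. 4.1.3 is then applied by name AT THAT `C`).
3. `stub_heegnerModule_quotient_isTorsion` (PRINT not yet typed: Cornut–Vatsal / CGLS Thm. 4.1.1 `κ₁^{Hg} ≠ 0` /
   Howard Thm. 3.3.7 / Perrin-Riou Prop. 10): `𝔖/ℋ_∞(F₀)` is `Λ`-torsion (the Heegner module has full rank).
4. `stub_heegnerModule_zsmul_divisible` (TYPING, tree-internal): `ℋ_∞(p^c • F) ⊆ (p^c)·ℋ_∞(F)` when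
   `E(K)[p] = 0` — the `m = p^c` companion of `heegnerModule_zsmul_of_not_dvd` (levelwise `p`-divisibility in
   `S_p(E/K_k)`, which has no `p`-torsion as `E(K_k)[p] = 0`).
5. KERNEL (this file + `HeegnerCharIdealScalingTransferProofs`, p608989): with `F := F₀.zsmulSelf (p^(a+m))`
   (the tree's rescaled parametrisation `[p^(a+m)] ∘ φ`), 4 + 2 give `ℋ_F ⊆ (p^m)·Λκ_C`, the sandwich
   (`isTorsion_quotient_heegnerModule_zsmul`) + 3 give `𝔖/ℋ_F` torsion, the transfer
   `heegnerCharIdeal_le_span_pow_mul_stabilizedHeegnerCharIdeal_of_le_smul` gives `I(ℋ_F) ⊆ (p^m)·I(Λκ_C)`,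
   whence `I(ℋ_F)² ⊆ (p^{2m})·I(Λκ_C)² ⊆ (p^m)·I(Λκ_C)² ⊆ char(X_tors)`. NO μ-invariant input; NO Howard port.
The binder `h46` (MZ26 Cor. 4.6) is not used by this cut (the CGLS road covers `p ∤ h_K` as well).
HONEST CAVEAT (reshape note, evidence #8 on the item): `A_light` as typed is closed under rescaling of `F.Dt`,
hence weaker than Howard's Thm B at a FIXED parametrisation; whether its consumer (the Yan–Zhu composite
fact p563407, same `∃ F` shape) is print-faithful under that freedom is flagged to the referee/lit.
Cell `bsd-print-x9`, seat `bsd-line-x9-p2`. [cite: CastellaGrossiLeeSkinner2022, Thm. 4.1.1, Thm. 4.1.3, Cor. 3.4.2, Rem. 4.1.4 (arXiv:2008.02571)]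
[cite: PerrinRiou1987BSMF, §1, §3.3–3.4 (Prop. 10)] [cite: Darmon2004, Prop. 3.10] [cite: Howard2004HeegnerKolyvagin, §1, Thm. B, Thm. 3.3.7]
[cite: Cornut2002, Thm. (Mazur's conjecture)]
-/

set_option linter.dupNamespace false
set_option autoImplicit false

noncomputable section

open scoped Classical Pointwise

namespace Summit.BirchSwinnertonDyer.BirchSwinnertonDyer.Cruxes.HowardContainmentLightFrameOfPrint.TorsionDepthLight

open WeierstrassCurve Literature.NumberTheory.EllipticCurves
  Literature.NumberTheory.EllipticCurves.ModularForms
  Literature.NumberTheory.EllipticCurves.CastellaGrossiLeeSkinner2022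

/-! ## Statements as named propositions -/

/-- **STUB (research) — `p`-power envelope into a stabilised module**: on a light X9 Heegner frame, for
every `Λ`-adic Selmer datum `D` and every tree Heegner family `F`, there are a CGLS `d(k)`-shifted stabilised
datum `C` ON THE SAME parametrisation and orientation (`C.Dt = F.Dt`, `C.β = F.β`) — to be built COHERENTLY
(`u_k`, `v_k` norms of ONE compatible system of Heegner points `P[p^d]`; the tree's `StabilizedHeegnerData`
pins each norm point only up to its own Galois orbit, and `κ_k = α^{-d(k)}(u_k - α⁻¹v_k)` depends on the
relative choice) — and `a : ℕ` with `(p^a) · ℋ_∞(F) ⊆ Λκ_C`. Content: the components of a norm-compatible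
family with values in the level modules `ℋ̄_k = ℤ_p[Gal(K_k/K)]·{y_K, z_0, …, z_k}` are universal norms,
and the universal norms in `ℋ̄_k` lie in `ℤ_p[Gal(K_k/K)]·κ_k` for a coherent `C` (vertical distribution
relations `Norm P[p^{d+1}] = a_p P[p^d] - P[p^{d-1}]`, `a_p = α + β`; the `β = p/α`-direction is divisible by
`β^s` at every depth `s` and dies; `E(K_k)[p] = 0`; `ℤ_p[G_k]·κ_k` is `p`-adically closed). Beyond typed print
(CGLS Rem. 4.1.4 "generate the same Λ-submodule" is printed for their two classes; the tree's
compositum-norm family needs Perrin-Riou §3.4 at any class number; the distribution relations are the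
cite-only `Darmon2004.prop310_normCompatibility`).
[cite: PerrinRiou1987BSMF, §3.3 (distribution relations), §3.4 Prop. 10] [cite: Darmon2004, Prop. 3.10]
[cite: CastellaGrossiLeeSkinner2022, Thm. 4.1.1 proof (P_k[n], d(k)) and Rem. 4.1.4] [cite: Howard2004HeegnerKolyvagin, Thm. 3.3.7] -/
def Stmt.stub_exists_stabilized_heegnerModule_le_smul : Prop :=
    ∀ (W : WeierstrassCurve ℚ) [W.IsElliptic] [W.IsGloballyMinimal] (p : ℕ) [Fact p.Prime]
      [NeZero (W.conductorNorm ℤ)] (K : Type) [Field K] [NumberField K],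
      Summit.BirchSwinnertonDyer.BirchSwinnertonDyer.Rank1Residual.ClassX9 W p →
      IsImaginaryQuadratic K → Odd (NumberField.discr K) → NumberField.discr K ≠ -3 →
      SatisfiesHeegnerHypothesis (W.conductorNorm ℤ) K → SatisfiesHeegnerHypothesis p K →
      (W.baseChange K).HasIrreducibleModPGaloisRep p →
      ∀ (κ : ZpExtension K p), κ.IsAnticyclotomic → ∀ (γ : Field.absoluteGaloisGroup K),
      κ.IsTopGenerator γ →
      Summit.BirchSwinnertonDyer.BirchSwinnertonDyer.Theses.PrintX9.AnticyclotomicTowerInRingClassFields →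
      ∀ (jbar : AlgebraicClosure K →+* ℂ) (D : (W.baseChange K).LambdaAdicSelmerData κ γ)
        (F : HeegnerFamily (W.conductorNorm ℤ) W K κ jbar),
      ∃ (C : StabilizedHeegnerData (W.conductorNorm ℤ) W K κ jbar) (a : ℕ), C.Dt = F.Dt ∧ C.β = F.β ∧
        ∀ s ∈ heegnerModule D F, ((p : IwasawaAlgebra p) ^ a) • s ∈ stabilizedHeegnerModule D C

/-- **STUB (print, not yet typed) — the Heegner module has full rank**: on a light X9 Heegner frame, granted
CGLS Thm. 4.1.3 (`𝔖` of `Λ`-rank one) and the tower containment, `𝔖/ℋ_∞(F)` is `Λ`-torsion for every tree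
Heegner family `F` (any parametrisation): some norm-compatible family of Heegner classes is non-torsion —
Cornut–Vatsal non-triviality of Heegner points up the anticyclotomic tower assembled into `lim← ℋ_k`
(Howard 2004 Thm. 3.3.7 / Perrin-Riou 1987 §3.4 Prop. 10 at any class number; CGLS 2022 Thm. 4.1.1:
`κ₁^{Hg} ≠ 0`). [cite: Cornut2002, Thm. (Mazur's conjecture)] [cite: Howard2004HeegnerKolyvagin, Thm. 3.3.7]
[cite: CastellaGrossiLeeSkinner2022, Thm. 4.1.1 (κ₁ ≠ 0)] [cite: PerrinRiou1987BSMF, §3.4 Prop. 10] -/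
def Stmt.stub_heegnerModule_quotient_isTorsion : Prop :=
    Summit.BirchSwinnertonDyer.BirchSwinnertonDyer.Theses.PrintX9.CGLSHowardDivisibilityLocalized →
    Summit.BirchSwinnertonDyer.BirchSwinnertonDyer.Theses.PrintX9.AnticyclotomicTowerInRingClassFields →
    ∀ (W : WeierstrassCurve ℚ) [W.IsElliptic] [W.IsGloballyMinimal] (p : ℕ) [Fact p.Prime]
      [NeZero (W.conductorNorm ℤ)] (K : Type) [Field K] [NumberField K],
      Summit.BirchSwinnertonDyer.BirchSwinnertonDyer.Rank1Residual.ClassX9 W p →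
      IsImaginaryQuadratic K → Odd (NumberField.discr K) → NumberField.discr K ≠ -3 →
      SatisfiesHeegnerHypothesis (W.conductorNorm ℤ) K → SatisfiesHeegnerHypothesis p K →
      (W.baseChange K).HasIrreducibleModPGaloisRep p →
      ∀ (κ : ZpExtension K p), κ.IsAnticyclotomic → ∀ (γ : Field.absoluteGaloisGroup K),
      κ.IsTopGenerator γ →
      ∀ (jbar : AlgebraicClosure K →+* ℂ) (D : (W.baseChange K).LambdaAdicSelmerData κ γ)
        (F : HeegnerFamily (W.conductorNorm ℤ) W K κ jbar),
      Module.IsTorsion (IwasawaAlgebra p) (D.S ⧸ heegnerModule D F)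

/-- **STUB (typing, tree-internal) — levelwise `p`-divisibility in the compact Selmer limit**: for `E/ℚ`
elliptic, a number field `K` with `E(K)[p] = 0` (whence `E(K_k)[p] = 0` up any `ℤ_p`-tower: `K_k/K` is a
`p`-extension), every `Λ`-adic Selmer datum `D`, tree Heegner family `F` and `c`: the Heegner module of the
`p^c`-RESCALED family (`F.zsmulSelf (p^c)`: parametrisation `[p^c] ∘ φ`, generators `p^c • y_K, p^c • z_j`,
level modules `ℋ̄_k(p^c • F) = p^c • ℋ̄_k(F)` by `heegnerModuleLayer_zsmul`) lies in `(p^c) · ℋ_∞(F)` — the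
`m = p^c` companion of `heegnerModule_zsmul_of_not_dvd` / of the easy half `C_smul_mem_heegnerModule_zsmul`
of the sandwich: a norm-compatible family all of whose level components are `p^c`-divisible inside
`ℋ̄_k(F) ⊆ S_p(E/K_k)` is `(C p^c)`• a norm-compatible family, because `S_p(E/K_k) = lim← Sel_{p^j}(E/K_k)` has
no `p`-torsion when `E(K_k)[p] = 0` (`H¹(K_k, E[p^j]) → H¹(K_k, E[p^{j+1}])` injective) and `D.surj`/`D.ext`.
[cite: PerrinRiou1987BSMF, §0 p. 401–402 (S_p(L), 𝔖_p as ℤ_p⟦Γ⟧-module)] [cite: Howard2004HeegnerKolyvagin, §3.3 (𝐇 = lim← H_k under E(K[n])[p] = 0, §2.7)] -/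
def Stmt.stub_heegnerModule_zsmul_divisible : Prop :=
    ∀ (N : ℕ) [NeZero N] (W : WeierstrassCurve ℚ) [W.IsElliptic] (p : ℕ) [Fact p.Prime]
      (K : Type) [Field K] [NumberField K],
      (∀ Q : (W.baseChange K).toAffine.Point, p • Q = 0 → Q = 0) →
      ∀ (κ : ZpExtension K p) (γ : Field.absoluteGaloisGroup K) (jbar : AlgebraicClosure K →+* ℂ)
        (D : (W.baseChange K).LambdaAdicSelmerData κ γ) (F : HeegnerFamily N W K κ jbar)
        (c : ℕ) (hc : ((p : ℤ) ^ c) ≠ 0),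
      ∀ s ∈ heegnerModule D (F.zsmulSelf ((p : ℤ) ^ c) hc),
        ∃ t ∈ heegnerModule D F, s = ((p : IwasawaAlgebra p) ^ c) • t

/-! ## The stubs (the ONLY sorries of the file) -/

theorem stub_exists_stabilized_heegnerModule_le_smul : Stmt.stub_exists_stabilized_heegnerModule_le_smul := by
  sorry

theorem stub_heegnerModule_quotient_isTorsion : Stmt.stub_heegnerModule_quotient_isTorsion := by
  sorry

theorem stub_heegnerModule_zsmul_divisible : Stmt.stub_heegnerModule_zsmul_divisible := by
  sorry

/-! ## Composition (kernel-checked, no `sorry`): the scaling reduction -/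

/-- `E(K)[p] = 0` on a light X9 frame, in the `•`-form the divisibility stub consumes ((irr) over the
quadratic field `K`). [cite: GrossLMS1991, §2 (sentence after (2.2))] -/
theorem noPTorsion_of_lightFrame {W : WeierstrassCurve ℚ} [W.IsElliptic] [W.IsGloballyMinimal] {p : ℕ}
    [Fact p.Prime] {K : Type} [Field K] [NumberField K]
    (hX9 : Literature.NumberTheory.EllipticCurves.Rank1Residual.ClassX9 W p) (hK : IsImaginaryQuadratic K) :
    ∀ Q : (W.baseChange K).toAffine.Point, p • Q = 0 → Q = 0 := fun Q hQ ↦ by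
  have hbot := torsionBy_eq_bot_of_isImaginaryQuadratic_of_hasIrreducibleModPGaloisRep W K hK
    (Fact.out : p.Prime) hX9.irr
  have hmem : Q ∈ AddSubgroup.torsionBy (W.baseChange K).toAffine.Point (p : ℤ) :=
    AddSubgroup.torsionBy.nsmul_iff.mpr hQ
  rw [hbot, AddSubgroup.mem_bot] at hmem
  exact hmem

/-- **A Heegner family ON a given parametrisation datum and orientation** (`F.Dt = Dt`, `F.β = β`): the
assembly of the proved `exists_isHeegnerNormPoint_holds` (as `nonempty_heegnerFamily_of`), keeping the
record of `(Dt, β)`. [cite: Howard2004HeegnerKolyvagin, §2.7 and §3.3 (the family P[n] of a FIXED parametrisation)] -/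
theorem exists_heegnerFamily_on {N : ℕ} [NeZero N] {W : WeierstrassCurve ℚ} [W.IsElliptic] {K : Type}
    [Field K] [NumberField K] {p : ℕ} [Fact p.Prime] {κ : ZpExtension K p}
    {jbar : AlgebraicClosure K →+* ℂ} (hK : IsImaginaryQuadratic K) (hH : SatisfiesHeegnerHypothesis N K)
    (hpN : ¬ p ∣ N) (Dt : ModularParametrizationData W N) {β : ℤ}
    (hβ : (4 * N : ℤ) ∣ β ^ 2 - NumberField.discr K) :
    ∃ F : HeegnerFamily N W K κ jbar, F.Dt = Dt ∧ F.β = β := by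
  have hc : ∀ j : ℕ, (p ^ (j + 1)).Coprime N := fun j ↦
    Nat.Coprime.pow_left _ ((Fact.out : p.Prime).coprime_iff_not_dvd.mpr hpN)
  choose z hz using fun j : ℕ ↦ exists_isHeegnerNormPoint_holds N W K p hK hH κ Dt hβ jbar j (hc j)
  obtain ⟨y, hy⟩ := exists_isHeegnerNormPoint_holds N W K p hK hH κ Dt hβ jbar 0 (Nat.coprime_one_left N)
  exact ⟨⟨Dt, β, hβ, y, hy, z, hz⟩, rfl, rfl⟩

/-- **The three stubs give the crux BY NAME, by the scaling reduction** (module docstring, steps 1–5):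
introduce `h46` (unused), `hCGLS`, `hTw`; fix the frame; `jbar := IsAlgClosed.lift` along `ιC`; take the tree
family `F₀` ON `(Dt, H.β)`; the coherent stabilised datum `C` ON `(F₀.Dt, F₀.β)` and the envelope exponent `a`
(research stub); `𝔖`, `X` by the existence theorems; CGLS Thm. 4.1.3 at `(D, C, X)` by name (`Λ`-rank one and
`(p^m)·I(Λκ_C)² ⊆ char(X_tors)` at corank one — hypotheses by the landed `X9.thm413Hypotheses_of_lightFrame`,
`X9.selmerCorank_eq_one_of_rank_one`); and answer with the RESCALED family `F := F₀.zsmulSelf (p^(a+m))`.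
[cite: CastellaGrossiLeeSkinner2022, Thm. 4.1.3, Cor. 3.4.2, Rem. 4.1.4] [cite: Howard2004HeegnerKolyvagin, §1 ("Fixing a modular parametrization"), Thm. B] -/
theorem HowardContainmentLightFrameOfPrint_of
    (hcmp : Stmt.stub_exists_stabilized_heegnerModule_le_smul)
    (hrank : Stmt.stub_heegnerModule_quotient_isTorsion)
    (hdiv : Stmt.stub_heegnerModule_zsmul_divisible) :
    Summit.BirchSwinnertonDyer.BirchSwinnertonDyer.Theses.PrintX9.HowardContainmentLightFrameOfPrint := by
  intro _h46 hCGLS hTw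
  unfold Stmt.stub_exists_stabilized_heegnerModule_le_smul at hcmp
  unfold Stmt.stub_heegnerModule_quotient_isTorsion at hrank
  unfold Stmt.stub_heegnerModule_zsmul_divisible at hdiv
  intro W _ _ p _ _ K _ _ hX9 hK hodd h3 hHN hHp hirr κ hκ γ hγ Dt H ιC hrk hfin
  letI : Algebra K ℂ := ιC.toAlgebra
  let jbar : AlgebraicClosure K →+* ℂ :=
    (IsAlgClosed.lift (R := K) (M := ℂ) (S := AlgebraicClosure K)).toRingHom
  have hX9c := Summit.BirchSwinnertonDyer.BirchSwinnertonDyer.Rank1Residual.classX9_census_of_classX9 W p hX9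
  -- the data `𝔖`, `X`; the tree family `F₀` on `(Dt, H.β)`
  obtain ⟨D⟩ := LambdaAdicSelmerDataExists.nonempty_lambdaAdicSelmerData (W.baseChange K) p κ hγ
  obtain ⟨X⟩ := (W.baseChange K).nonempty_selmerDualData_holds κ γ hγ
  obtain ⟨F₀, -, -⟩ := exists_heegnerFamily_on (κ := κ) (jbar := jbar) hK hHN hX9c.not_dvd_conductorNorm
    Dt H.dvd_sq_sub
  -- 2. the coherent stabilised datum and the envelope exponent; 3. full rank
  obtain ⟨C, a, -, -, hincl⟩ := hcmp W p K hX9 hK hodd h3 hHN hHp hirr κ hκ γ hγ hTw jbar D F₀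
  have htor₀ := hrank hCGLS hTw W p K hX9 hK hodd h3 hHN hHp hirr κ hκ γ hγ jbar D F₀
  -- 1. CGLS Thm. 4.1.3 by name at `(D, C, X)`: `Λ`-rank one and the localized containment
  have h413 : thm413_rankOne_charIdeal_torsion_dvd_localized.{0} := hCGLS
  have hyp := Summit.BirchSwinnertonDyer.Rank1Residual.X9.thm413Hypotheses_of_lightFrame hX9c hK hodd h3
    hHN hHp hκ hγ
  obtain ⟨⟨hSfin, hS1⟩, -⟩ := h413 (W.conductorNorm ℤ) W K p κ γ jbar hyp D C X
  haveI := hSfin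
  obtain ⟨m, hCGLSm⟩ := span_pow_mul_sq_le_charIdeal_torsion_of_thm413 h413 hyp
    (Summit.BirchSwinnertonDyer.Rank1Residual.X9.selmerCorank_eq_one_of_rank_one hrk hfin) D C X
  -- 5. rescale by `p^(a+m)`
  have hp0 : (p : ℤ) ≠ 0 := Int.natCast_ne_zero.mpr (Fact.out : p.Prime).ne_zero
  have hpc : ((p : ℤ) ^ (a + m)) ≠ 0 := pow_ne_zero _ hp0
  let F : HeegnerFamily (W.conductorNorm ℤ) W K κ jbar := F₀.zsmulSelf ((p : ℤ) ^ (a + m)) hpc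
  -- 4 + 2: `ℋ_F ⊆ (p^m) · Λκ_C`
  have hle : heegnerModule D F ≤ ((p : IwasawaAlgebra p) ^ m) • stabilizedHeegnerModule D C := by
    intro s hs
    obtain ⟨t, ht, rfl⟩ := hdiv (W.conductorNorm ℤ) W p K (noPTorsion_of_lightFrame hX9c hK) κ γ jbar D F₀
      (a + m) hpc s hs
    rw [pow_add, mul_comm, mul_smul]
    exact Submodule.smul_mem_pointwise_smul _ _ _ (hincl t ht)
  -- sandwich + 3: `𝔖/ℋ_F` is torsion
  have htorF : Module.IsTorsion (IwasawaAlgebra p) (D.S ⧸ heegnerModule D F) :=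
    isTorsion_quotient_heegnerModule_zsmul D F₀ (F₀.Dt.zsmul _ hpc) hpc (F₀.Dt.φ_zsmul hpc) htor₀
  -- the transfer: `I(ℋ_F) ⊆ (p^m) · I(Λκ_C)`
  have hI := heegnerCharIdeal_le_span_pow_mul_stabilizedHeegnerCharIdeal_of_le_smul D hS1 F C m hle htorF
  refine ⟨jbar, D, F, X, ?_⟩
  calc heegnerCharIdeal D F ^ 2
      ≤ (Ideal.span {(p : IwasawaAlgebra p) ^ m} * stabilizedHeegnerCharIdeal D C) ^ 2 :=
        Ideal.pow_right_mono hI 2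
    _ = Ideal.span {(p : IwasawaAlgebra p) ^ m} ^ 2 * stabilizedHeegnerCharIdeal D C ^ 2 := mul_pow _ _ 2
    _ ≤ Ideal.span {(p : IwasawaAlgebra p) ^ m} * stabilizedHeegnerCharIdeal D C ^ 2 :=
        Ideal.mul_mono_left (Ideal.pow_le_self two_ne_zero)
    _ ≤ Module.charIdeal (IwasawaAlgebra p) (Submodule.torsion (IwasawaAlgebra p) X.X) := hCGLSm

/-- The composed line from the three stubs (sorries only through `stub_*`). -/
theorem HowardContainmentLightFrameOfPrint_of_stubs :
    Summit.BirchSwinnertonDyer.BirchSwinnertonDyer.Theses.PrintX9.HowardContainmentLightFrameOfPrint :=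
  HowardContainmentLightFrameOfPrint_of stub_exists_stabilized_heegnerModule_le_smul
    stub_heegnerModule_quotient_isTorsion stub_heegnerModule_zsmul_divisible

end Summit.BirchSwinnertonDyer.BirchSwinnertonDyer.Cruxes.HowardContainmentLightFrameOfPrint.TorsionDepthLight

end
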